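import Literature.Probability.RandomPlanarGeometry.SAWPulledLargeForceExpansionZdThirdSymbol
import HarnessLib

/-!
# Pulled SAW on `ℤ^{d+1}`: the FOURTH-ORDER symbol ENGINE (quadruple calculus, census quadruple, recursion step)

Topic `Literature/Probability/RandomPlanarGeometry` (continues `SAWPulledLargeForceExpansionZdThirdSymbol.lean` — CAR F: third-order symbol
calculus, ★★ `exists_polynomial_costCoeffZd_topThree`, ★ `exists_polynomial_costCoeffZd_spanTwo`, ★★★ `[d^{k−2}] c_k^{(d)} = (−1)^{k−1}2^{k−2}(k²−5k+7)`;
uses `SAWPulledLargeForceExpansionZdDegreeProfile.lean` (`deg_d N_{c,n} ≤ 3c+2−2n`), `…ZdFourthOrder.lean` (`costCoeffZd_eq_zero_of_le`,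
`costCoeffZd_eq_zero_of_three_span`), `SAWIrreducibleBridgeSpanOne.lean` (`costCoeffZd_self_succ`) and the tree's engine `CostSeries.Pz / A`).

PRINTED CONTEXT (locators only, no digit quoted). Madras–Slade (1993) §1.1 eq. (1.1.8) p. 5 (the `1/d` expansion of `μ`); Clisby–Liang–Slade (2007)
§1.3 eq. (1)/(3) (the expansions of `μ` and of the amplitude `A` to orders `(2d)^{-11}`, `(2d)^{-12}`). NOT IN PRINT: the lane objects below.

THIS FILE (lane «pcv-sawmu», a-p1 g19; all PROVED, standard axioms, NO definitions) is the ENGINE of the fourth 1/d-symbol of the large-force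
coefficients `c_k^{(d)}`, one order beyond CAR F, with the two census inputs that are not yet theorems carried as DATA:
* PART I — fourth-order symbol calculus on QUADRUPLES `([X^m]P, [X^m](P·X), [X^m](P·X²), [X^m](P·X³))` (inline predicate; private `gsc4_*`),
  and for families `d ↦ S_d ∈ ℤ[X]`: `symbolQuad_one/mul/pow/sub/sum` — products `(a,b,c,e)(a′,b′,c′,e′) = (aa′, ab′+ba′, ac′+bb′+ca′,
  ae′+bc′+cb′+ea′)` via `Polynomial.reflect`, powers `(σⁿ, nσⁿ⁻¹τ, nσⁿ⁻¹υ + C(n,2)σⁿ⁻²τ², nσⁿ⁻¹λ + 2C(n,2)σⁿ⁻²τυ + C(n,3)σⁿ⁻³τ³)`.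
* PART II — ★★ `exists_polynomial_costCoeffZd_topFour (t s)`: THE CENSUS QUADRUPLE. Hypotheses: for `c ≥ 3` a polynomial of degree `≤ c` for
  `c_c(ℤ^d)` with `d^{c−3}`-coefficient `t c`; for `c ≥ 4` one of degree `≤ c−2` for the span-two cell `N_{c,c+2}(ℤ^{d+1})` with `d^{c−3}`-coefficient
  `s c` (these coefficients EXIST and are unique — the hypotheses only NAME them; the lane's laws `t c = −(2^{c−4}/3)(c³−12c²+59c−138)`,
  `s c = −(2^{c−3}/6)(c⁴−12c³+65c²−180c+198)` (FINDING-ZD-FOURTH-SYMBOL, Am. BC) are NOT used). Conclusion: every cell `N_{c,n}` has the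
  quadruple (CAR F's triple, fourth = `[n=c+1]·t c·[c≥3] + [n=c+2]·s c·[c≥4]`); the span-three cell and beyond do not reach `d^{c−3}`.
* PART III — ★ `symbolQuad_A_succ (t s)`: ONE RECURSION STEP on the quadruples of `[X^i] A_K`: the first three components are CAR F's, the
  fourth is `−Σ_c X^c (2^c E_{c+1} − (c−1)2^{c−1} C_{c+1} + t₃(c) B_{c+1} + t₄(c) σ^{c+1} + s₃(c) B_{c+2} + s₄(c) σ^{c+2})` in the power
  quadruple `(σⁿ, B_n, C_n, E_n)`.
DELIBERATELY NOT HERE (next car, designed in the lane's `DESIGN-ZD-HIGHER-SYMBOLS.md` with every certificate derived): the fourth-order fixed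
point `λ = λ₀ − ι²·Σ_c X^c(t(c)ι^{c+1} + s(c)ι^{c+2})`, `λ₀ = −4X⁵(7+12X+60X²+40X³)(1+2X)^{-7}` (telescoping certificate
`Σ_{j≤K} w^{j+1}G_j = A₄(w) + w^{K+2}R₄(K,w)`, scale `96ι⁴`), and the RESPONSE THEOREM `[d^{k−3}] c_k^{(d)} = [X^k] 4X⁵(5+14X+52X²+40X³)(1+2X)^{-5}
+ Σ_c (t(c)[X^{k−c}](1+2X)^{-c-1} + s(c)[X^{k−c}](1+2X)^{-c-2})`, which with the two laws gives `(−1)^{k−1}2^{k−3}(k−3)(k−4)(5k²−35k+56)/12`.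
[cite: MadrasSlade1993, §1.1 eq. (1.1.8) p. 5; §4.2 eq. (4.2.20)–(4.2.22)] [cite: ClisbyLiangSlade2007, §1.3 eq. (1)/(3)]

Provenance: lane «pcv-sawmu», a-p1 g19 (2026-08-26).
-/

noncomputable section

open Finset
open scoped BigOperators
open Literature.Probability.LatticeModels
open Literature.Probability.RandomPlanarGeometry.SAW

namespace Literature.Probability.RandomPlanarGeometry.SAW.Zd

/-! ### Fourth-order symbols of polynomial-in-`d` functions

Inline predicate: `∃ P : ℚ[X], P.natDegree ≤ m ∧ P.coeff m = a ∧ (P * X).coeff m = b ∧ (P * X^2).coeff m = c ∧ (P * X^3).coeff m = e ∧ ∀ d : ℕ, f d = P.eval d`. -/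

section Symbol4

/-- `[X^0]` of the reflection is the top coefficient. [cite: MadrasSlade1993, §1.1 eq. (1.1.8) p. 5; lane plumbing] -/
private theorem sq_reflect_coeff_zero (P : Polynomial ℚ) (m : ℕ) : (Polynomial.reflect m P).coeff 0 = P.coeff m := by
  rw [Polynomial.coeff_reflect, Polynomial.revAt_le (Nat.zero_le m), Nat.sub_zero]

/-- `[X^k]` of the reflection is `[X^m](P · X^k)` when `deg P ≤ m`. [cite: MadrasSlade1993, §1.1 eq. (1.1.8) p. 5; lane plumbing] -/
private theorem sq_reflect_coeff {P : Polynomial ℚ} {m : ℕ} (hP : P.natDegree ≤ m) (k : ℕ) :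
    (Polynomial.reflect m P).coeff k = (P * Polynomial.X ^ k).coeff m := by
  rw [Polynomial.coeff_reflect, Polynomial.coeff_mul_X_pow']
  by_cases h : k ≤ m
  · rw [Polynomial.revAt_le h, if_pos h]
  · rw [if_neg h]
    have h1 : Polynomial.revAt m k = k := by
      unfold Polynomial.revAt
      simp only [Function.Embedding.coeFn_mk, ite_eq_right_iff]
      omega
    rw [h1]
    exact Polynomial.coeff_eq_zero_of_natDegree_lt (by omega)

/-- `[X^3](p · q) = p₀q₃ + p₁q₂ + p₂q₁ + p₃q₀`. [cite: MadrasSlade1993, §1.1 eq. (1.1.8) p. 5; lane plumbing] -/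
private theorem sq_coeff_three_mul (p q : Polynomial ℚ) :
    (p * q).coeff 3 = p.coeff 0 * q.coeff 3 + p.coeff 1 * q.coeff 2 + p.coeff 2 * q.coeff 1 + p.coeff 3 * q.coeff 0 := by
  rw [Polynomial.coeff_mul, Finset.Nat.sum_antidiagonal_succ, Finset.Nat.sum_antidiagonal_succ, Finset.Nat.sum_antidiagonal_succ,
    Finset.Nat.antidiagonal_zero, Finset.sum_singleton]
  ring

/-- `[X^2](p · q) = p₀q₂ + p₁q₁ + p₂q₀`. [cite: MadrasSlade1993, §1.1 eq. (1.1.8) p. 5; lane plumbing] -/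
private theorem sq_coeff_two_mul (p q : Polynomial ℚ) :
    (p * q).coeff 2 = p.coeff 0 * q.coeff 2 + p.coeff 1 * q.coeff 1 + p.coeff 2 * q.coeff 0 := by
  rw [Polynomial.coeff_mul, Finset.Nat.sum_antidiagonal_succ, Finset.Nat.sum_antidiagonal_succ,
    Finset.Nat.antidiagonal_zero, Finset.sum_singleton]
  ring

/-- `[X^1](p · q) = p₀ q₁ + p₁ q₀`. [cite: MadrasSlade1993, §1.1 eq. (1.1.8) p. 5; lane plumbing] -/
private theorem sq_coeff_one_mul (p q : Polynomial ℚ) : (p * q).coeff 1 = p.coeff 0 * q.coeff 1 + p.coeff 1 * q.coeff 0 := by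
  rw [Polynomial.coeff_mul, Finset.Nat.sum_antidiagonal_succ, Finset.Nat.antidiagonal_zero, Finset.sum_singleton]

/-- The `X^k`-shifted coefficients of a product, `k ≤ 3`: `[X^{m+m'}](P·Q·X^k) = Σ_{i+j=k} [X^m](P·X^i)·[X^{m'}](Q·X^j)`.
[cite: MadrasSlade1993, §1.1 eq. (1.1.8) p. 5; lane plumbing] -/
private theorem sq_coeff_mul_mul_X_pow {P Q : Polynomial ℚ} {m m' : ℕ} (hP : P.natDegree ≤ m) (hQ : Q.natDegree ≤ m') :
    (P * Q * Polynomial.X ^ 1).coeff (m + m') =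
      (P * Polynomial.X ^ 0).coeff m * (Q * Polynomial.X ^ 1).coeff m' + (P * Polynomial.X ^ 1).coeff m * (Q * Polynomial.X ^ 0).coeff m' ∧
    (P * Q * Polynomial.X ^ 2).coeff (m + m') =
      (P * Polynomial.X ^ 0).coeff m * (Q * Polynomial.X ^ 2).coeff m' + (P * Polynomial.X ^ 1).coeff m * (Q * Polynomial.X ^ 1).coeff m' +
        (P * Polynomial.X ^ 2).coeff m * (Q * Polynomial.X ^ 0).coeff m' ∧
    (P * Q * Polynomial.X ^ 3).coeff (m + m') =
      (P * Polynomial.X ^ 0).coeff m * (Q * Polynomial.X ^ 3).coeff m' + (P * Polynomial.X ^ 1).coeff m * (Q * Polynomial.X ^ 2).coeff m' +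
        (P * Polynomial.X ^ 2).coeff m * (Q * Polynomial.X ^ 1).coeff m' + (P * Polynomial.X ^ 3).coeff m * (Q * Polynomial.X ^ 0).coeff m' := by
  have hPQ : (P * Q).natDegree ≤ m + m' := Polynomial.natDegree_mul_le.trans (add_le_add hP hQ)
  refine ⟨?_, ?_, ?_⟩
  · rw [← sq_reflect_coeff hPQ 1, Polynomial.reflect_mul P Q hP hQ, sq_coeff_one_mul, ← sq_reflect_coeff hP, ← sq_reflect_coeff hP,
      ← sq_reflect_coeff hQ, ← sq_reflect_coeff hQ]
  · rw [← sq_reflect_coeff hPQ 2, Polynomial.reflect_mul P Q hP hQ, sq_coeff_two_mul, ← sq_reflect_coeff hP, ← sq_reflect_coeff hP,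
      ← sq_reflect_coeff hP, ← sq_reflect_coeff hQ, ← sq_reflect_coeff hQ, ← sq_reflect_coeff hQ]
  · rw [← sq_reflect_coeff hPQ 3, Polynomial.reflect_mul P Q hP hQ, sq_coeff_three_mul, ← sq_reflect_coeff hP, ← sq_reflect_coeff hP,
      ← sq_reflect_coeff hP, ← sq_reflect_coeff hP, ← sq_reflect_coeff hQ, ← sq_reflect_coeff hQ, ← sq_reflect_coeff hQ, ← sq_reflect_coeff hQ]

/-- Products: quadruples multiply as `(a,b,c,e)(a',b',c',e') = (aa', ab'+ba', ac'+bb'+ca', ae'+bc'+cb'+ea')`.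
[cite: MadrasSlade1993, §1.1 eq. (1.1.8) p. 5; lane plumbing] -/
private theorem gsc4_mul {f g : ℕ → ℚ} {m m' : ℕ} {a b c e a' b' c' e' : ℚ}
    (hf : ∃ P : Polynomial ℚ, P.natDegree ≤ m ∧ P.coeff m = a ∧ (P * Polynomial.X).coeff m = b ∧
      (P * Polynomial.X ^ 2).coeff m = c ∧ (P * Polynomial.X ^ 3).coeff m = e ∧ ∀ d : ℕ, f d = P.eval (d : ℚ))
    (hg : ∃ P : Polynomial ℚ, P.natDegree ≤ m' ∧ P.coeff m' = a' ∧ (P * Polynomial.X).coeff m' = b' ∧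
      (P * Polynomial.X ^ 2).coeff m' = c' ∧ (P * Polynomial.X ^ 3).coeff m' = e' ∧ ∀ d : ℕ, g d = P.eval (d : ℚ)) :
    ∃ P : Polynomial ℚ, P.natDegree ≤ m + m' ∧ P.coeff (m + m') = a * a' ∧
      (P * Polynomial.X).coeff (m + m') = a * b' + b * a' ∧
      (P * Polynomial.X ^ 2).coeff (m + m') = a * c' + b * b' + c * a' ∧
      (P * Polynomial.X ^ 3).coeff (m + m') = a * e' + b * c' + c * b' + e * a' ∧ ∀ d : ℕ, f d * g d = P.eval (d : ℚ) := by
  obtain ⟨P, hP, hPa, hPb, hPc, hPe, hf⟩ := hf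
  obtain ⟨Q, hQ, hQa, hQb, hQc, hQe, hg⟩ := hg
  obtain ⟨h1, h2, h3⟩ := sq_coeff_mul_mul_X_pow hP hQ
  simp only [pow_zero, mul_one, pow_one] at h1 h2 h3
  refine ⟨P * Q, Polynomial.natDegree_mul_le.trans (add_le_add hP hQ),
    by rw [Polynomial.coeff_mul_add_eq_of_natDegree_le hP hQ, hPa, hQa], ?_, ?_, ?_, fun d => by rw [hf, hg, Polynomial.eval_mul]⟩
  · rw [h1, hPa, hPb, hQa, hQb]
  · rw [h2, hPa, hPb, hPc, hQa, hQb, hQc]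
  · rw [h3, hPa, hPb, hPc, hPe, hQa, hQb, hQc, hQe]

/-- Differences. [cite: MadrasSlade1993, §1.1 eq. (1.1.8) p. 5; lane plumbing] -/
private theorem gsc4_sub {f g : ℕ → ℚ} {m : ℕ} {a b c e a' b' c' e' : ℚ}
    (hf : ∃ P : Polynomial ℚ, P.natDegree ≤ m ∧ P.coeff m = a ∧ (P * Polynomial.X).coeff m = b ∧
      (P * Polynomial.X ^ 2).coeff m = c ∧ (P * Polynomial.X ^ 3).coeff m = e ∧ ∀ d : ℕ, f d = P.eval (d : ℚ))
    (hg : ∃ P : Polynomial ℚ, P.natDegree ≤ m ∧ P.coeff m = a' ∧ (P * Polynomial.X).coeff m = b' ∧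
      (P * Polynomial.X ^ 2).coeff m = c' ∧ (P * Polynomial.X ^ 3).coeff m = e' ∧ ∀ d : ℕ, g d = P.eval (d : ℚ)) :
    ∃ P : Polynomial ℚ, P.natDegree ≤ m ∧ P.coeff m = a - a' ∧ (P * Polynomial.X).coeff m = b - b' ∧
      (P * Polynomial.X ^ 2).coeff m = c - c' ∧ (P * Polynomial.X ^ 3).coeff m = e - e' ∧ ∀ d : ℕ, f d - g d = P.eval (d : ℚ) := by
  obtain ⟨P, hP, hPa, hPb, hPc, hPe, hf⟩ := hf
  obtain ⟨Q, hQ, hQa, hQb, hQc, hQe, hg⟩ := hg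
  exact ⟨P - Q, (Polynomial.natDegree_sub_le _ _).trans (max_le hP hQ), by rw [Polynomial.coeff_sub, hPa, hQa],
    by rw [sub_mul, Polynomial.coeff_sub, hPb, hQb], by rw [sub_mul, Polynomial.coeff_sub, hPc, hQc],
    by rw [sub_mul, Polynomial.coeff_sub, hPe, hQe], fun d => by rw [hf, hg, Polynomial.eval_sub]⟩

/-- Finite sums. [cite: MadrasSlade1993, §1.1 eq. (1.1.8) p. 5; lane plumbing] -/
private theorem gsc4_sum {ι : Type*} (s : Finset ι) {f : ι → ℕ → ℚ} {m : ℕ} {a b c e : ι → ℚ}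
    (h : ∀ i ∈ s, ∃ P : Polynomial ℚ, P.natDegree ≤ m ∧ P.coeff m = a i ∧ (P * Polynomial.X).coeff m = b i ∧
      (P * Polynomial.X ^ 2).coeff m = c i ∧ (P * Polynomial.X ^ 3).coeff m = e i ∧ ∀ d : ℕ, f i d = P.eval (d : ℚ)) :
    ∃ P : Polynomial ℚ, P.natDegree ≤ m ∧ P.coeff m = ∑ i ∈ s, a i ∧ (P * Polynomial.X).coeff m = ∑ i ∈ s, b i ∧
      (P * Polynomial.X ^ 2).coeff m = ∑ i ∈ s, c i ∧ (P * Polynomial.X ^ 3).coeff m = ∑ i ∈ s, e i ∧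
      ∀ d : ℕ, (∑ i ∈ s, f i d) = P.eval (d : ℚ) := by
  classical
  induction s using Finset.induction_on with
  | empty => exact ⟨0, by simp, by simp, by simp, by simp, by simp, fun d => by simp⟩
  | @insert i s hi ih =>
    obtain ⟨P, hP, hPa, hPb, hPc, hPe, hf⟩ := h i (Finset.mem_insert_self i s)
    obtain ⟨Q, hQ, hQa, hQb, hQc, hQe, hg⟩ := ih fun j hj => h j (Finset.mem_insert_of_mem hj)
    refine ⟨P + Q, (Polynomial.natDegree_add_le _ _).trans (max_le hP hQ), ?_, ?_, ?_, ?_, fun d => ?_⟩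
    · rw [Polynomial.coeff_add, hPa, hQa, Finset.sum_insert hi]
    · rw [add_mul, Polynomial.coeff_add, hPb, hQb, Finset.sum_insert hi]
    · rw [add_mul, Polynomial.coeff_add, hPc, hQc, Finset.sum_insert hi]
    · rw [add_mul, Polynomial.coeff_add, hPe, hQe, Finset.sum_insert hi]
    · rw [Finset.sum_insert hi, hf, hg, Polynomial.eval_add]

/-- Equal symbol values. [cite: MadrasSlade1993, §1.1 eq. (1.1.8) p. 5; lane plumbing] -/
private theorem gsc4_of_eq {f : ℕ → ℚ} {m : ℕ} {a b c e a' b' c' e' : ℚ} (ha : a = a') (hb : b = b') (hc : c = c') (he : e = e')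
    (h : ∃ P : Polynomial ℚ, P.natDegree ≤ m ∧ P.coeff m = a ∧ (P * Polynomial.X).coeff m = b ∧
      (P * Polynomial.X ^ 2).coeff m = c ∧ (P * Polynomial.X ^ 3).coeff m = e ∧ ∀ d : ℕ, f d = P.eval (d : ℚ)) :
    ∃ P : Polynomial ℚ, P.natDegree ≤ m ∧ P.coeff m = a' ∧ (P * Polynomial.X).coeff m = b' ∧
      (P * Polynomial.X ^ 2).coeff m = c' ∧ (P * Polynomial.X ^ 3).coeff m = e' ∧ ∀ d : ℕ, f d = P.eval (d : ℚ) := by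
  subst ha hb hc he; exact h

/-- Raising a degree bound by four kills the quadruple. [cite: MadrasSlade1993, §1.1 eq. (1.1.8) p. 5; lane plumbing] -/
private theorem gsc4_raise_four {f : ℕ → ℚ} {m m' : ℕ} (h : ∃ P : Polynomial ℚ, P.natDegree ≤ m ∧ ∀ d : ℕ, f d = P.eval (d : ℚ))
    (hm : m + 4 ≤ m') :
    ∃ P : Polynomial ℚ, P.natDegree ≤ m' ∧ P.coeff m' = 0 ∧ (P * Polynomial.X).coeff m' = 0 ∧
      (P * Polynomial.X ^ 2).coeff m' = 0 ∧ (P * Polynomial.X ^ 3).coeff m' = 0 ∧ ∀ d : ℕ, f d = P.eval (d : ℚ) := by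
  obtain ⟨P, hP, hf⟩ := h
  have hPX : ∀ k : ℕ, (P * Polynomial.X ^ k).natDegree ≤ m + k := fun k =>
    Polynomial.natDegree_mul_le.trans (by rw [Polynomial.natDegree_X_pow]; omega)
  refine ⟨P, hP.trans (by omega), Polynomial.coeff_eq_zero_of_natDegree_lt (by omega), ?_, ?_, ?_, hf⟩
  · rw [← pow_one Polynomial.X]
    exact Polynomial.coeff_eq_zero_of_natDegree_lt (by have := hPX 1; omega)
  · exact Polynomial.coeff_eq_zero_of_natDegree_lt (by have := hPX 2; omega)
  · exact Polynomial.coeff_eq_zero_of_natDegree_lt (by have := hPX 3; omega)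

/-- A triple in degree `m` whose polynomial has degree `≤ m − 3`... (lift of a known third coefficient three degrees up):
a function of degree `≤ m` with top coefficient `a` has quadruple `(0, 0, 0, a)` in degree `m + 3`.
[cite: MadrasSlade1993, §1.1 eq. (1.1.8) p. 5; lane plumbing] -/
private theorem gsc4_raise_three {f : ℕ → ℚ} {m : ℕ} {a : ℚ}
    (h : ∃ P : Polynomial ℚ, P.natDegree ≤ m ∧ P.coeff m = a ∧ ∀ d : ℕ, f d = P.eval (d : ℚ)) :
    ∃ P : Polynomial ℚ, P.natDegree ≤ m + 3 ∧ P.coeff (m + 3) = 0 ∧ (P * Polynomial.X).coeff (m + 3) = 0 ∧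
      (P * Polynomial.X ^ 2).coeff (m + 3) = 0 ∧ (P * Polynomial.X ^ 3).coeff (m + 3) = a ∧ ∀ d : ℕ, f d = P.eval (d : ℚ) := by
  obtain ⟨P, hP, hPa, hf⟩ := h
  refine ⟨P, hP.trans (by omega), Polynomial.coeff_eq_zero_of_natDegree_lt (by omega), ?_, ?_, ?_, hf⟩
  · rw [Polynomial.coeff_mul_X]
    exact Polynomial.coeff_eq_zero_of_natDegree_lt (by omega)
  · rw [show m + 3 = (m + 1) + 2 by ring, Polynomial.coeff_mul_X_pow]
    exact Polynomial.coeff_eq_zero_of_natDegree_lt (by omega)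
  · rw [Polynomial.coeff_mul_X_pow, hPa]

/-! #### Families `d ↦ S_d ∈ ℤ[X]` with symbol QUADRUPLE `(σ, τ, υ, λ)` up to order `K` -/

/-- The constant family `1` has quadruple `(1, 0, 0, 0)`. [cite: MadrasSlade1993, §1.1 eq. (1.1.8) p. 5; lane plumbing] -/
theorem symbolQuad_one (K : ℕ) : ∀ i ≤ K, ∃ P : Polynomial ℚ, P.natDegree ≤ i ∧ P.coeff i = (1 : Polynomial ℚ).coeff i ∧
    (P * Polynomial.X).coeff i = (0 : Polynomial ℚ).coeff i ∧ (P * Polynomial.X ^ 2).coeff i = (0 : Polynomial ℚ).coeff i ∧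
    (P * Polynomial.X ^ 3).coeff i = (0 : Polynomial ℚ).coeff i ∧
    ∀ d : ℕ, ((((1 : Polynomial ℤ)).coeff i : ℤ) : ℚ) = P.eval (d : ℚ) := by
  intro i _
  by_cases hi : i = 0
  · subst hi
    refine ⟨1, by simp, by simp, ?_, ?_, ?_, fun d => by simp⟩
    · rw [one_mul, Polynomial.coeff_X_zero, Polynomial.coeff_zero]
    · rw [one_mul, Polynomial.coeff_X_pow, Polynomial.coeff_zero, if_neg (by decide)]
    · rw [one_mul, Polynomial.coeff_X_pow, Polynomial.coeff_zero, if_neg (by decide)]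
  · refine ⟨0, by simp, by simp [Polynomial.coeff_one, hi], by simp, by simp, by simp, fun d => by simp [Polynomial.coeff_one, hi]⟩

/-- Products of families: `(σ,τ,υ,λ)(σ',τ',υ',λ') = (σσ', στ'+τσ', συ'+ττ'+υσ', σλ'+τυ'+υτ'+λσ')`.
[cite: MadrasSlade1993, §1.1 eq. (1.1.8) p. 5; lane plumbing] -/
theorem symbolQuad_mul {S T : ℕ → Polynomial ℤ} {σ τ υ μ σ' τ' υ' μ' : Polynomial ℚ} {K : ℕ}
    (hS : ∀ i ≤ K, ∃ P : Polynomial ℚ, P.natDegree ≤ i ∧ P.coeff i = σ.coeff i ∧ (P * Polynomial.X).coeff i = τ.coeff i ∧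
      (P * Polynomial.X ^ 2).coeff i = υ.coeff i ∧ (P * Polynomial.X ^ 3).coeff i = μ.coeff i ∧
      ∀ d : ℕ, (((S d).coeff i : ℤ) : ℚ) = P.eval (d : ℚ))
    (hT : ∀ i ≤ K, ∃ P : Polynomial ℚ, P.natDegree ≤ i ∧ P.coeff i = σ'.coeff i ∧ (P * Polynomial.X).coeff i = τ'.coeff i ∧
      (P * Polynomial.X ^ 2).coeff i = υ'.coeff i ∧ (P * Polynomial.X ^ 3).coeff i = μ'.coeff i ∧
      ∀ d : ℕ, (((T d).coeff i : ℤ) : ℚ) = P.eval (d : ℚ)) :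
    ∀ i ≤ K, ∃ P : Polynomial ℚ, P.natDegree ≤ i ∧ P.coeff i = (σ * σ').coeff i ∧
      (P * Polynomial.X).coeff i = (σ * τ' + τ * σ').coeff i ∧
      (P * Polynomial.X ^ 2).coeff i = (σ * υ' + τ * τ' + υ * σ').coeff i ∧
      (P * Polynomial.X ^ 3).coeff i = (σ * μ' + τ * υ' + υ * τ' + μ * σ').coeff i ∧
      ∀ d : ℕ, (((S d * T d).coeff i : ℤ) : ℚ) = P.eval (d : ℚ) := by
  intro i hi
  have key : ∃ P : Polynomial ℚ, P.natDegree ≤ i ∧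
      P.coeff i = ∑ x ∈ antidiagonal i, σ.coeff x.1 * σ'.coeff x.2 ∧
      (P * Polynomial.X).coeff i = ∑ x ∈ antidiagonal i, (σ.coeff x.1 * τ'.coeff x.2 + τ.coeff x.1 * σ'.coeff x.2) ∧
      (P * Polynomial.X ^ 2).coeff i = ∑ x ∈ antidiagonal i,
        (σ.coeff x.1 * υ'.coeff x.2 + τ.coeff x.1 * τ'.coeff x.2 + υ.coeff x.1 * σ'.coeff x.2) ∧
      (P * Polynomial.X ^ 3).coeff i = ∑ x ∈ antidiagonal i,
        (σ.coeff x.1 * μ'.coeff x.2 + τ.coeff x.1 * υ'.coeff x.2 + υ.coeff x.1 * τ'.coeff x.2 + μ.coeff x.1 * σ'.coeff x.2) ∧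
      ∀ d : ℕ, (∑ x ∈ antidiagonal i, (((S d).coeff x.1 : ℚ)) * ((T d).coeff x.2 : ℚ)) = P.eval (d : ℚ) := by
    refine gsc4_sum _ fun x hx => ?_
    have hx' : x.1 + x.2 = i := mem_antidiagonal.1 hx
    have h := gsc4_mul (hS x.1 (by omega)) (hT x.2 (by omega))
    rwa [hx'] at h
  obtain ⟨P, hP, hPa, hPb, hPc, hPe, h⟩ := key
  refine ⟨P, hP, by rw [hPa, Polynomial.coeff_mul], ?_, ?_, ?_, fun d => ?_⟩
  · rw [hPb, Polynomial.coeff_add, Polynomial.coeff_mul, Polynomial.coeff_mul, ← Finset.sum_add_distrib]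
  · rw [hPc, Polynomial.coeff_add, Polynomial.coeff_add, Polynomial.coeff_mul, Polynomial.coeff_mul, Polynomial.coeff_mul,
      ← Finset.sum_add_distrib, ← Finset.sum_add_distrib]
  · rw [hPe, Polynomial.coeff_add, Polynomial.coeff_add, Polynomial.coeff_add, Polynomial.coeff_mul, Polynomial.coeff_mul,
      Polynomial.coeff_mul, Polynomial.coeff_mul, ← Finset.sum_add_distrib, ← Finset.sum_add_distrib, ← Finset.sum_add_distrib]
  · rw [← h d, Polynomial.coeff_mul]
    push_cast
    rfl

/-- Powers of a family: quadruple `(σⁿ, nσⁿ⁻¹τ, nσⁿ⁻¹υ + C(n,2)σⁿ⁻²τ², nσⁿ⁻¹λ + 2C(n,2)σⁿ⁻²τυ + C(n,3)σⁿ⁻³τ³)`.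
[cite: MadrasSlade1993, §1.1 eq. (1.1.8) p. 5; lane plumbing] -/
theorem symbolQuad_pow {S : ℕ → Polynomial ℤ} {σ τ υ μ : Polynomial ℚ} {K : ℕ}
    (hS : ∀ i ≤ K, ∃ P : Polynomial ℚ, P.natDegree ≤ i ∧ P.coeff i = σ.coeff i ∧ (P * Polynomial.X).coeff i = τ.coeff i ∧
      (P * Polynomial.X ^ 2).coeff i = υ.coeff i ∧ (P * Polynomial.X ^ 3).coeff i = μ.coeff i ∧
      ∀ d : ℕ, (((S d).coeff i : ℤ) : ℚ) = P.eval (d : ℚ)) (n : ℕ) :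
    ∀ i ≤ K, ∃ P : Polynomial ℚ, P.natDegree ≤ i ∧ P.coeff i = (σ ^ n).coeff i ∧
      (P * Polynomial.X).coeff i = ((n : Polynomial ℚ) * σ ^ (n - 1) * τ).coeff i ∧
      (P * Polynomial.X ^ 2).coeff i =
        ((n : Polynomial ℚ) * σ ^ (n - 1) * υ + ((n.choose 2 : ℕ) : Polynomial ℚ) * σ ^ (n - 2) * τ ^ 2).coeff i ∧
      (P * Polynomial.X ^ 3).coeff i =
        ((n : Polynomial ℚ) * σ ^ (n - 1) * μ + 2 * ((n.choose 2 : ℕ) : Polynomial ℚ) * σ ^ (n - 2) * τ * υ +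
          ((n.choose 3 : ℕ) : Polynomial ℚ) * σ ^ (n - 3) * τ ^ 3).coeff i ∧
      ∀ d : ℕ, ((((S d) ^ n).coeff i : ℤ) : ℚ) = P.eval (d : ℚ) := by
  induction n with
  | zero =>
    intro i hi
    obtain ⟨P, hP, hPa, hPb, hPc, hPe, h⟩ := symbolQuad_one K i hi
    refine ⟨P, hP, by rw [hPa, pow_zero], by rw [hPb]; simp, by rw [hPc]; simp, by rw [hPe]; simp, fun d => by rw [← h d, pow_zero]⟩
  | succ n ih =>
    intro i hi
    obtain ⟨P, hP, hPa, hPb, hPc, hPe, h⟩ := symbolQuad_mul (S := fun d => S d ^ n) (T := S) ih hS i hi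
    have hid : σ ^ n * τ + (n : Polynomial ℚ) * σ ^ (n - 1) * τ * σ = ((n + 1 : ℕ) : Polynomial ℚ) * σ ^ (n + 1 - 1) * τ := by
      rcases n with _ | k
      · simp
      · rw [show k + 1 - 1 = k by omega, show k + 1 + 1 - 1 = k + 1 by omega, pow_succ]; push_cast; ring
    have hid2 : σ ^ n * υ + (n : Polynomial ℚ) * σ ^ (n - 1) * τ * τ +
        ((n : Polynomial ℚ) * σ ^ (n - 1) * υ + ((n.choose 2 : ℕ) : Polynomial ℚ) * σ ^ (n - 2) * τ ^ 2) * σ =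
        ((n + 1 : ℕ) : Polynomial ℚ) * σ ^ (n + 1 - 1) * υ +
          (((n + 1).choose 2 : ℕ) : Polynomial ℚ) * σ ^ (n + 1 - 2) * τ ^ 2 := by
      rcases n with _ | k
      · simp
      · rcases k with _ | k
        · simp; ring
        · rw [show k + 1 + 1 - 1 = k + 1 by omega, show k + 1 + 1 - 2 = k by omega, show k + 1 + 1 + 1 - 1 = k + 1 + 1 by omega,
            show k + 1 + 1 + 1 - 2 = k + 1 by omega, Nat.choose_succ_succ' (k + 1 + 1) 1, Nat.choose_one_right,
            pow_succ, pow_succ]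
          push_cast; ring
    have hid3 : σ ^ n * μ + (n : Polynomial ℚ) * σ ^ (n - 1) * τ * υ +
        ((n : Polynomial ℚ) * σ ^ (n - 1) * υ + ((n.choose 2 : ℕ) : Polynomial ℚ) * σ ^ (n - 2) * τ ^ 2) * τ +
        ((n : Polynomial ℚ) * σ ^ (n - 1) * μ + 2 * ((n.choose 2 : ℕ) : Polynomial ℚ) * σ ^ (n - 2) * τ * υ +
          ((n.choose 3 : ℕ) : Polynomial ℚ) * σ ^ (n - 3) * τ ^ 3) * σ =
        ((n + 1 : ℕ) : Polynomial ℚ) * σ ^ (n + 1 - 1) * μ + 2 * (((n + 1).choose 2 : ℕ) : Polynomial ℚ) * σ ^ (n + 1 - 2) * τ * υ +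
          (((n + 1).choose 3 : ℕ) : Polynomial ℚ) * σ ^ (n + 1 - 3) * τ ^ 3 := by
      rcases n with _ | k
      · simp
      · rcases k with _ | k
        · simp; ring
        · rcases k with _ | k
          · simp
            ring
          · rw [show k + 1 + 1 + 1 - 1 = k + 1 + 1 by omega, show k + 1 + 1 + 1 - 2 = k + 1 by omega, show k + 1 + 1 + 1 - 3 = k by omega,
              show k + 1 + 1 + 1 + 1 - 1 = k + 1 + 1 + 1 by omega, show k + 1 + 1 + 1 + 1 - 2 = k + 1 + 1 by omega,
              show k + 1 + 1 + 1 + 1 - 3 = k + 1 by omega, Nat.choose_succ_succ' (k + 1 + 1 + 1) 1,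
              Nat.choose_succ_succ' (k + 1 + 1 + 1) 2, Nat.choose_one_right, pow_succ, pow_succ, pow_succ]
            push_cast; ring
    refine ⟨P, hP, by rw [hPa, pow_succ], by rw [hPb, hid], by rw [hPc, hid2], by rw [hPe, hid3], fun d => by rw [← h d, pow_succ]⟩

/-- Differences of families. [cite: MadrasSlade1993, §1.1 eq. (1.1.8) p. 5; lane plumbing] -/
theorem symbolQuad_sub {S T : ℕ → Polynomial ℤ} {σ τ υ μ σ' τ' υ' μ' : Polynomial ℚ} {K : ℕ}
    (hS : ∀ i ≤ K, ∃ P : Polynomial ℚ, P.natDegree ≤ i ∧ P.coeff i = σ.coeff i ∧ (P * Polynomial.X).coeff i = τ.coeff i ∧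
      (P * Polynomial.X ^ 2).coeff i = υ.coeff i ∧ (P * Polynomial.X ^ 3).coeff i = μ.coeff i ∧
      ∀ d : ℕ, (((S d).coeff i : ℤ) : ℚ) = P.eval (d : ℚ))
    (hT : ∀ i ≤ K, ∃ P : Polynomial ℚ, P.natDegree ≤ i ∧ P.coeff i = σ'.coeff i ∧ (P * Polynomial.X).coeff i = τ'.coeff i ∧
      (P * Polynomial.X ^ 2).coeff i = υ'.coeff i ∧ (P * Polynomial.X ^ 3).coeff i = μ'.coeff i ∧
      ∀ d : ℕ, (((T d).coeff i : ℤ) : ℚ) = P.eval (d : ℚ)) :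
    ∀ i ≤ K, ∃ P : Polynomial ℚ, P.natDegree ≤ i ∧ P.coeff i = (σ - σ').coeff i ∧
      (P * Polynomial.X).coeff i = (τ - τ').coeff i ∧ (P * Polynomial.X ^ 2).coeff i = (υ - υ').coeff i ∧
      (P * Polynomial.X ^ 3).coeff i = (μ - μ').coeff i ∧
      ∀ d : ℕ, (((S d - T d).coeff i : ℤ) : ℚ) = P.eval (d : ℚ) := by
  intro i hi
  obtain ⟨P, hP, hPa, hPb, hPc, hPe, h⟩ := gsc4_sub (hS i hi) (hT i hi)
  refine ⟨P, hP, by rw [hPa, Polynomial.coeff_sub], by rw [hPb, Polynomial.coeff_sub], by rw [hPc, Polynomial.coeff_sub],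
    by rw [hPe, Polynomial.coeff_sub], fun d => ?_⟩
  rw [← h d, Polynomial.coeff_sub]
  push_cast
  rfl

/-- Finite sums of families. [cite: MadrasSlade1993, §1.1 eq. (1.1.8) p. 5; lane plumbing] -/
theorem symbolQuad_sum {ι : Type*} (s : Finset ι) {S : ι → ℕ → Polynomial ℤ} {σ τ υ μ : ι → Polynomial ℚ} {K : ℕ}
    (hS : ∀ j ∈ s, ∀ i ≤ K, ∃ P : Polynomial ℚ, P.natDegree ≤ i ∧ P.coeff i = (σ j).coeff i ∧
      (P * Polynomial.X).coeff i = (τ j).coeff i ∧ (P * Polynomial.X ^ 2).coeff i = (υ j).coeff i ∧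
      (P * Polynomial.X ^ 3).coeff i = (μ j).coeff i ∧
      ∀ d : ℕ, (((S j d).coeff i : ℤ) : ℚ) = P.eval (d : ℚ)) :
    ∀ i ≤ K, ∃ P : Polynomial ℚ, P.natDegree ≤ i ∧ P.coeff i = (∑ j ∈ s, σ j).coeff i ∧
      (P * Polynomial.X).coeff i = (∑ j ∈ s, τ j).coeff i ∧ (P * Polynomial.X ^ 2).coeff i = (∑ j ∈ s, υ j).coeff i ∧
      (P * Polynomial.X ^ 3).coeff i = (∑ j ∈ s, μ j).coeff i ∧
      ∀ d : ℕ, (((∑ j ∈ s, S j d).coeff i : ℤ) : ℚ) = P.eval (d : ℚ) := by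
  intro i hi
  obtain ⟨P, hP, hPa, hPb, hPc, hPe, h⟩ := gsc4_sum s (fun j hj => hS j hj i hi)
  refine ⟨P, hP, by rw [hPa, Polynomial.finsetSum_coeff], by rw [hPb, Polynomial.finsetSum_coeff],
    by rw [hPc, Polynomial.finsetSum_coeff], by rw [hPe, Polynomial.finsetSum_coeff], fun d => ?_⟩
  rw [← h d, Polynomial.finsetSum_coeff]
  push_cast
  rfl

end Symbol4

/-! ### The symbol quadruple of the cost census (fourth symbols as hypotheses `t`, `s`) -/

section Census4

/-- A polynomial over `ℚ` is determined by its values on `ℕ`. [cite: MadrasSlade1993, §1.1 eq. (1.1.8) p. 5; lane plumbing] -/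
private theorem alg4_poly_eq {P Q : Polynomial ℚ} (h : ∀ d : ℕ, P.eval (d : ℚ) = Q.eval (d : ℚ)) : P = Q := by
  apply Polynomial.eq_of_infinite_eval_eq P Q
  refine Set.Infinite.mono ?_ (Set.infinite_range_of_injective Nat.cast_injective)
  rintro x ⟨d, rfl⟩
  exact h d

/-- A function of degree `≤ m + 1` with top two coefficients `a, b` has quadruple `(0, 0, a, b)` in degree `m + 3`.
[cite: MadrasSlade1993, §1.1 eq. (1.1.8) p. 5; lane plumbing] -/
private theorem gsc4_raise_two {f : ℕ → ℚ} {m : ℕ} {a b : ℚ}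
    (h : ∃ P : Polynomial ℚ, P.natDegree ≤ m + 1 ∧ P.coeff (m + 1) = a ∧ P.coeff m = b ∧ ∀ d : ℕ, f d = P.eval (d : ℚ)) :
    ∃ P : Polynomial ℚ, P.natDegree ≤ m + 3 ∧ P.coeff (m + 3) = 0 ∧ (P * Polynomial.X).coeff (m + 3) = 0 ∧
      (P * Polynomial.X ^ 2).coeff (m + 3) = a ∧ (P * Polynomial.X ^ 3).coeff (m + 3) = b ∧ ∀ d : ℕ, f d = P.eval (d : ℚ) := by
  obtain ⟨P, hP, hPa, hPb, hf⟩ := h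
  refine ⟨P, hP.trans (by omega), Polynomial.coeff_eq_zero_of_natDegree_lt (by omega), ?_, ?_, ?_, hf⟩
  · rw [Polynomial.coeff_mul_X]
    exact Polynomial.coeff_eq_zero_of_natDegree_lt (by omega)
  · rw [show m + 3 = (m + 1) + 2 by ring, Polynomial.coeff_mul_X_pow, hPa]
  · rw [Polynomial.coeff_mul_X_pow, hPb]

/-- ★★ THE SYMBOL QUADRUPLE OF THE COST CENSUS, with the FOURTH symbols as data: if `t c` is the `d^{c−3}`-coefficient of `c_c(ℤ^d)`
(`c ≥ 3`) and `s c` that of the span-two cell `N_{c,c+2}(ℤ^{d+1})` (`c ≥ 4`), then for `c ≥ 1` the cell `d ↦ N_{c,n}(ℤ^{d+1})` has quadruple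
(top three as in `exists_polynomial_costCoeffZd_topThree`, fourth `[n=c+1]·t c + [n=c+2]·s c`, zero for `c` below the thresholds); the
span-three cell and beyond do not reach `d^{c−3}` (degree profile). [cite: MadrasSlade1993, §1.1 eq. (1.1.8) p. 5; §4.2 eq. (4.2.20)–(4.2.22); lane theorem] -/
theorem exists_polynomial_costCoeffZd_topFour (t s : ℕ → ℚ)
    (ht : ∀ c : ℕ, 3 ≤ c → ∃ P : Polynomial ℚ, P.natDegree ≤ c ∧ P.coeff (c - 3) = t c ∧ ∀ d : ℕ, (count d c : ℚ) = P.eval (d : ℚ))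
    (hs : ∀ c : ℕ, 4 ≤ c → ∃ P : Polynomial ℚ, P.natDegree ≤ c - 2 ∧ P.coeff (c - 3) = s c ∧
      ∀ d : ℕ, (costCoeffZd d c (c + 2) : ℚ) = P.eval (d : ℚ))
    {c : ℕ} (hc : 1 ≤ c) (n : ℕ) :
    ∃ P : Polynomial ℚ, P.natDegree ≤ c ∧ P.coeff c = (if n = c + 1 then (2 : ℚ) ^ c else 0) ∧
      (P * Polynomial.X).coeff c = (if n = c + 1 then -((c : ℚ) - 1) * 2 ^ (c - 1) else 0) ∧
      (P * Polynomial.X ^ 2).coeff c =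
        (if n = c + 1 then (if 3 ≤ c then (2 : ℚ) ^ (c - 3) * ((c : ℚ) ^ 2 - 5 * c + 8) else 0)
          else if n = c + 2 then (((c - 1).choose 3 : ℕ) : ℚ) * 2 ^ (c - 2) else 0) ∧
      (P * Polynomial.X ^ 3).coeff c =
        (if n = c + 1 then (if 3 ≤ c then t c else 0) else if n = c + 2 then (if 4 ≤ c then s c else 0) else 0) ∧
      ∀ d : ℕ, (costCoeffZd d c n : ℚ) = P.eval (d : ℚ) := by
  -- the triple of the cell, from the third-symbol file
  obtain ⟨P, hP, hPa, hPb, hPc, hev⟩ := exists_polynomial_costCoeffZd_topThree hc n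
  by_cases hn : n = c + 1
  · subst hn
    rw [if_pos rfl] at hPa hPb hPc
    rw [if_pos rfl, if_pos rfl, if_pos rfl, if_pos rfl]
    refine ⟨P, hP, hPa, hPb, hPc, ?_, hev⟩
    by_cases h3 : 3 ≤ c
    · rw [if_pos h3]
      obtain ⟨Q, hQ, hQt, hQev⟩ := ht c h3
      have hPQ : P = Q := alg4_poly_eq fun d => by rw [← hev d, costCoeffZd_self_succ, hQev d]
      obtain ⟨m, rfl⟩ : ∃ m, c = m + 3 := ⟨c - 3, by omega⟩
      rw [Polynomial.coeff_mul_X_pow, hPQ, ← hQt, show m + 3 - 3 = m by omega]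
    · rw [if_neg h3, Polynomial.coeff_mul_X_pow', if_neg h3]
  · rw [if_neg hn] at hPa hPb hPc
    rw [if_neg hn, if_neg hn, if_neg hn, if_neg hn]
    by_cases hn2 : n = c + 2
    · subst hn2
      rw [if_pos rfl] at hPc
      rw [if_pos rfl, if_pos rfl]
      by_cases h4 : 4 ≤ c
      · rw [if_pos h4]
        obtain ⟨m, rfl⟩ : ∃ m, c = m + 4 := ⟨c - 4, by omega⟩
        obtain ⟨R, hR, hRm, hRev⟩ := exists_polynomial_costCoeffZd_spanTwo (m + 2)
        obtain ⟨Q, hQ, hQs, hQev⟩ := hs (m + 4) h4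
        have hRQ : R = Q := alg4_poly_eq fun d => by rw [← hRev d, hQev d]
        rw [show m + 4 - 3 = m + 1 by omega] at hQs
        rw [show m + 4 - 1 = m + 3 by omega, show m + 4 - 2 = m + 2 by omega]
        have h := gsc4_raise_two (m := m + 1) (f := fun d => (costCoeffZd d (m + 4) (m + 4 + 2) : ℚ)) (a := (((m + 3).choose 3 : ℕ) : ℚ) * 2 ^ (m + 2))
          (b := s (m + 4)) ⟨R, hR, hRm, by rw [hRQ]; exact hQs, hRev⟩
        obtain ⟨P', hP', h1, h2, h3', h4', hev'⟩ := h
        exact ⟨P', hP', h1, h2, h3', h4', hev'⟩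
      · -- `c ≤ 3`: the span-two cell is empty
        rw [if_neg h4]
        refine ⟨0, by simp, by simp, by simp, ?_, by simp, fun d => ?_⟩
        · rw [zero_mul, Polynomial.coeff_zero]
          have : (c - 1).choose 3 = 0 := Nat.choose_eq_zero_of_lt (by omega)
          rw [this]; simp
        · rw [costCoeffZd_eq_zero_of_three_span (by omega) (by omega)]; simp
    · rw [if_neg hn2] at hPc
      rw [if_neg hn2, if_neg hn2]
      rcases Nat.lt_or_ge n (c + 1) with hlt | hge
      · -- `n ≤ c`: empty cell
        refine ⟨0, by simp, by simp, by simp, by simp, by simp, fun d => ?_⟩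
        rw [costCoeffZd_eq_zero_of_le (by omega : n ≤ c)]; simp
      · -- `n ≥ c + 3`
        rcases Nat.lt_or_ge (3 * c + 2) (2 * n) with hempty | hdeg
        · refine ⟨0, by simp, by simp, by simp, by simp, by simp, fun d => ?_⟩
          rw [costCoeffZd_eq_zero_of_lt hempty]; simp
        · obtain ⟨Q, hQ, hQev⟩ := exists_polynomial_costCoeffZd_degree_profile c n
          exact gsc4_raise_four ⟨Q, hQ, hQev⟩ (by omega)

end Census4


/-! ### The symbol quadruples of the approximants `A_K`: one recursion step (fourth symbols `t`, `s` as data) -/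

section Engine4

set_option maxHeartbeats 400000 in
/-- ★ One recursion step on symbol QUADRUPLES: if `d ↦ A_K(N(ℤ^{d+1}))` has quadruple `(σ, τ, υ, λ)` up to order `K`, then `A_{K+1}` has, up to
order `K + 1`, the first three symbols of the third-symbol file and the FOURTH symbol
`−Σ_{c=1}^{K+1} X^c (2^c E_{c+1} − (c−1)2^{c−1} C_{c+1} + t₃(c) B_{c+1} + t₄(c) σ^{c+1} + s₃(c) B_{c+2} + s₄(c) σ^{c+2})` where
`(σⁿ, B_n, C_n, E_n)` is the power quadruple, `t₃, s₃` the third census symbols and `t₄(c) = t c·[c ≥ 3]`, `s₄(c) = s c·[c ≥ 4]` the fourth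
(written below with `c = j + 1`). [cite: MadrasSlade1993, §1.1 eq. (1.1.8) p. 5; lane lemma] -/
theorem symbolQuad_A_succ (t s : ℕ → ℚ)
    (ht : ∀ c : ℕ, 3 ≤ c → ∃ P : Polynomial ℚ, P.natDegree ≤ c ∧ P.coeff (c - 3) = t c ∧ ∀ d : ℕ, (count d c : ℚ) = P.eval (d : ℚ))
    (hs : ∀ c : ℕ, 4 ≤ c → ∃ P : Polynomial ℚ, P.natDegree ≤ c - 2 ∧ P.coeff (c - 3) = s c ∧
      ∀ d : ℕ, (costCoeffZd d c (c + 2) : ℚ) = P.eval (d : ℚ))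
    {K : ℕ} {σ τ υ μ : Polynomial ℚ}
    (hA : ∀ i ≤ K, ∃ P : Polynomial ℚ, P.natDegree ≤ i ∧ P.coeff i = σ.coeff i ∧ (P * Polynomial.X).coeff i = τ.coeff i ∧
      (P * Polynomial.X ^ 2).coeff i = υ.coeff i ∧ (P * Polynomial.X ^ 3).coeff i = μ.coeff i ∧
      ∀ d : ℕ, (((CostSeries.A (costCoeffZd d) K).coeff i : ℤ) : ℚ) = P.eval (d : ℚ)) :
    ∀ i ≤ K + 1, ∃ P : Polynomial ℚ, P.natDegree ≤ i ∧
      P.coeff i = (1 - ∑ j ∈ Finset.range (K + 1), Polynomial.C ((2 : ℚ) ^ (j + 1)) * Polynomial.X ^ (j + 1) * σ ^ (j + 2)).coeff i ∧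
      (P * Polynomial.X).coeff i = (0 - ∑ j ∈ Finset.range (K + 1), Polynomial.X ^ (j + 1) *
        (Polynomial.C ((2 : ℚ) ^ (j + 1)) * (((j + 2 : ℕ) : Polynomial ℚ) * σ ^ (j + 1) * τ) -
          Polynomial.C ((j : ℚ) * 2 ^ j) * σ ^ (j + 2))).coeff i ∧
      (P * Polynomial.X ^ 2).coeff i = (0 - ∑ j ∈ Finset.range (K + 1), Polynomial.X ^ (j + 1) *
        (Polynomial.C ((2 : ℚ) ^ (j + 1)) * (((j + 2 : ℕ) : Polynomial ℚ) * σ ^ (j + 1) * υ +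
            (((j + 2).choose 2 : ℕ) : Polynomial ℚ) * σ ^ j * τ ^ 2) -
          Polynomial.C ((j : ℚ) * 2 ^ j) * (((j + 2 : ℕ) : Polynomial ℚ) * σ ^ (j + 1) * τ) +
          Polynomial.C (if 2 ≤ j then (2 : ℚ) ^ (j - 2) * ((j : ℚ) ^ 2 - 3 * j + 4) else 0) * σ ^ (j + 2) +
          Polynomial.C (((j.choose 3 : ℕ) : ℚ) * 2 ^ (j - 1)) * σ ^ (j + 3))).coeff i ∧
      (P * Polynomial.X ^ 3).coeff i = (0 - ∑ j ∈ Finset.range (K + 1), Polynomial.X ^ (j + 1) *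
        (Polynomial.C ((2 : ℚ) ^ (j + 1)) * (((j + 2 : ℕ) : Polynomial ℚ) * σ ^ (j + 1) * μ +
            2 * (((j + 2).choose 2 : ℕ) : Polynomial ℚ) * σ ^ j * τ * υ + (((j + 2).choose 3 : ℕ) : Polynomial ℚ) * σ ^ (j - 1) * τ ^ 3) -
          Polynomial.C ((j : ℚ) * 2 ^ j) * (((j + 2 : ℕ) : Polynomial ℚ) * σ ^ (j + 1) * υ +
            (((j + 2).choose 2 : ℕ) : Polynomial ℚ) * σ ^ j * τ ^ 2) +
          Polynomial.C (if 2 ≤ j then (2 : ℚ) ^ (j - 2) * ((j : ℚ) ^ 2 - 3 * j + 4) else 0) * (((j + 2 : ℕ) : Polynomial ℚ) * σ ^ (j + 1) * τ) +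
          Polynomial.C (if 2 ≤ j then t (j + 1) else 0) * σ ^ (j + 2) +
          Polynomial.C (((j.choose 3 : ℕ) : ℚ) * 2 ^ (j - 1)) * (((j + 3 : ℕ) : Polynomial ℚ) * σ ^ (j + 2) * τ) +
          Polynomial.C (if 3 ≤ j then s (j + 1) else 0) * σ ^ (j + 3))).coeff i ∧
      ∀ d : ℕ, (((CostSeries.A (costCoeffZd d) (K + 1)).coeff i : ℤ) : ℚ) = P.eval (d : ℚ) := by
  intro i hi
  have hterm : ∀ j ∈ Finset.range (K + 1), ∃ P : Polynomial ℚ, P.natDegree ≤ i ∧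
      P.coeff i = (Polynomial.C ((2 : ℚ) ^ (j + 1)) * Polynomial.X ^ (j + 1) * σ ^ (j + 2)).coeff i ∧
      (P * Polynomial.X).coeff i = (Polynomial.X ^ (j + 1) *
        (Polynomial.C ((2 : ℚ) ^ (j + 1)) * (((j + 2 : ℕ) : Polynomial ℚ) * σ ^ (j + 1) * τ) -
          Polynomial.C ((j : ℚ) * 2 ^ j) * σ ^ (j + 2))).coeff i ∧
      (P * Polynomial.X ^ 2).coeff i = (Polynomial.X ^ (j + 1) *
        (Polynomial.C ((2 : ℚ) ^ (j + 1)) * (((j + 2 : ℕ) : Polynomial ℚ) * σ ^ (j + 1) * υ +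
            (((j + 2).choose 2 : ℕ) : Polynomial ℚ) * σ ^ j * τ ^ 2) -
          Polynomial.C ((j : ℚ) * 2 ^ j) * (((j + 2 : ℕ) : Polynomial ℚ) * σ ^ (j + 1) * τ) +
          Polynomial.C (if 2 ≤ j then (2 : ℚ) ^ (j - 2) * ((j : ℚ) ^ 2 - 3 * j + 4) else 0) * σ ^ (j + 2) +
          Polynomial.C (((j.choose 3 : ℕ) : ℚ) * 2 ^ (j - 1)) * σ ^ (j + 3))).coeff i ∧
      (P * Polynomial.X ^ 3).coeff i = (Polynomial.X ^ (j + 1) *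
        (Polynomial.C ((2 : ℚ) ^ (j + 1)) * (((j + 2 : ℕ) : Polynomial ℚ) * σ ^ (j + 1) * μ +
            2 * (((j + 2).choose 2 : ℕ) : Polynomial ℚ) * σ ^ j * τ * υ + (((j + 2).choose 3 : ℕ) : Polynomial ℚ) * σ ^ (j - 1) * τ ^ 3) -
          Polynomial.C ((j : ℚ) * 2 ^ j) * (((j + 2 : ℕ) : Polynomial ℚ) * σ ^ (j + 1) * υ +
            (((j + 2).choose 2 : ℕ) : Polynomial ℚ) * σ ^ j * τ ^ 2) +
          Polynomial.C (if 2 ≤ j then (2 : ℚ) ^ (j - 2) * ((j : ℚ) ^ 2 - 3 * j + 4) else 0) * (((j + 2 : ℕ) : Polynomial ℚ) * σ ^ (j + 1) * τ) +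
          Polynomial.C (if 2 ≤ j then t (j + 1) else 0) * σ ^ (j + 2) +
          Polynomial.C (((j.choose 3 : ℕ) : ℚ) * 2 ^ (j - 1)) * (((j + 3 : ℕ) : Polynomial ℚ) * σ ^ (j + 2) * τ) +
          Polynomial.C (if 3 ≤ j then s (j + 1) else 0) * σ ^ (j + 3))).coeff i ∧ ∀ d : ℕ,
      (((Polynomial.X ^ (j + 1) * (CostSeries.Pz (costCoeffZd d) (j + 1)).comp (CostSeries.A (costCoeffZd d) K)).coeff i : ℤ) : ℚ) =
        P.eval (d : ℚ) := by
    intro j _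
    have hcoef : (Polynomial.C ((2 : ℚ) ^ (j + 1)) * Polynomial.X ^ (j + 1) * σ ^ (j + 2)).coeff i =
        if j + 1 ≤ i then (2 : ℚ) ^ (j + 1) * (σ ^ (j + 2)).coeff (i - (j + 1)) else 0 := by
      rw [mul_assoc, Polynomial.coeff_C_mul, Polynomial.coeff_X_pow_mul']
      split_ifs <;> simp
    have hcoef2 : (Polynomial.X ^ (j + 1) * (Polynomial.C ((2 : ℚ) ^ (j + 1)) * (((j + 2 : ℕ) : Polynomial ℚ) * σ ^ (j + 1) * τ) -
          Polynomial.C ((j : ℚ) * 2 ^ j) * σ ^ (j + 2))).coeff i =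
        if j + 1 ≤ i then (2 : ℚ) ^ (j + 1) * ((((j + 2 : ℕ) : Polynomial ℚ) * σ ^ (j + 1) * τ)).coeff (i - (j + 1)) -
          ((j : ℚ) * 2 ^ j) * (σ ^ (j + 2)).coeff (i - (j + 1)) else 0 := by
      rw [Polynomial.coeff_X_pow_mul']
      by_cases hji : j + 1 ≤ i
      · rw [if_pos hji, if_pos hji, Polynomial.coeff_sub, Polynomial.coeff_C_mul, Polynomial.coeff_C_mul]
      · rw [if_neg hji, if_neg hji]
    have hcoef3 : (Polynomial.X ^ (j + 1) *
        (Polynomial.C ((2 : ℚ) ^ (j + 1)) * (((j + 2 : ℕ) : Polynomial ℚ) * σ ^ (j + 1) * υ +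
            (((j + 2).choose 2 : ℕ) : Polynomial ℚ) * σ ^ j * τ ^ 2) -
          Polynomial.C ((j : ℚ) * 2 ^ j) * (((j + 2 : ℕ) : Polynomial ℚ) * σ ^ (j + 1) * τ) +
          Polynomial.C (if 2 ≤ j then (2 : ℚ) ^ (j - 2) * ((j : ℚ) ^ 2 - 3 * j + 4) else 0) * σ ^ (j + 2) +
          Polynomial.C (((j.choose 3 : ℕ) : ℚ) * 2 ^ (j - 1)) * σ ^ (j + 3))).coeff i =
        if j + 1 ≤ i then
          (2 : ℚ) ^ (j + 1) * ((((j + 2 : ℕ) : Polynomial ℚ) * σ ^ (j + 1) * υ +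
            (((j + 2).choose 2 : ℕ) : Polynomial ℚ) * σ ^ j * τ ^ 2)).coeff (i - (j + 1)) -
          ((j : ℚ) * 2 ^ j) * ((((j + 2 : ℕ) : Polynomial ℚ) * σ ^ (j + 1) * τ)).coeff (i - (j + 1)) +
          (if 2 ≤ j then (2 : ℚ) ^ (j - 2) * ((j : ℚ) ^ 2 - 3 * j + 4) else 0) * (σ ^ (j + 2)).coeff (i - (j + 1)) +
          (((j.choose 3 : ℕ) : ℚ) * 2 ^ (j - 1)) * (σ ^ (j + 3)).coeff (i - (j + 1)) else 0 := by
      rw [Polynomial.coeff_X_pow_mul']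
      by_cases hji : j + 1 ≤ i
      · rw [if_pos hji, if_pos hji, Polynomial.coeff_add, Polynomial.coeff_add, Polynomial.coeff_sub, Polynomial.coeff_C_mul,
          Polynomial.coeff_C_mul, Polynomial.coeff_C_mul, Polynomial.coeff_C_mul]
      · rw [if_neg hji, if_neg hji]
    have hcoef4 : (Polynomial.X ^ (j + 1) *
        (Polynomial.C ((2 : ℚ) ^ (j + 1)) * (((j + 2 : ℕ) : Polynomial ℚ) * σ ^ (j + 1) * μ +
            2 * (((j + 2).choose 2 : ℕ) : Polynomial ℚ) * σ ^ j * τ * υ + (((j + 2).choose 3 : ℕ) : Polynomial ℚ) * σ ^ (j - 1) * τ ^ 3) -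
          Polynomial.C ((j : ℚ) * 2 ^ j) * (((j + 2 : ℕ) : Polynomial ℚ) * σ ^ (j + 1) * υ +
            (((j + 2).choose 2 : ℕ) : Polynomial ℚ) * σ ^ j * τ ^ 2) +
          Polynomial.C (if 2 ≤ j then (2 : ℚ) ^ (j - 2) * ((j : ℚ) ^ 2 - 3 * j + 4) else 0) * (((j + 2 : ℕ) : Polynomial ℚ) * σ ^ (j + 1) * τ) +
          Polynomial.C (if 2 ≤ j then t (j + 1) else 0) * σ ^ (j + 2) +
          Polynomial.C (((j.choose 3 : ℕ) : ℚ) * 2 ^ (j - 1)) * (((j + 3 : ℕ) : Polynomial ℚ) * σ ^ (j + 2) * τ) +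
          Polynomial.C (if 3 ≤ j then s (j + 1) else 0) * σ ^ (j + 3))).coeff i =
        if j + 1 ≤ i then
          (2 : ℚ) ^ (j + 1) * ((((j + 2 : ℕ) : Polynomial ℚ) * σ ^ (j + 1) * μ +
            2 * (((j + 2).choose 2 : ℕ) : Polynomial ℚ) * σ ^ j * τ * υ + (((j + 2).choose 3 : ℕ) : Polynomial ℚ) * σ ^ (j - 1) * τ ^ 3)).coeff (i - (j + 1)) -
          ((j : ℚ) * 2 ^ j) * ((((j + 2 : ℕ) : Polynomial ℚ) * σ ^ (j + 1) * υ +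
            (((j + 2).choose 2 : ℕ) : Polynomial ℚ) * σ ^ j * τ ^ 2)).coeff (i - (j + 1)) +
          (if 2 ≤ j then (2 : ℚ) ^ (j - 2) * ((j : ℚ) ^ 2 - 3 * j + 4) else 0) * ((((j + 2 : ℕ) : Polynomial ℚ) * σ ^ (j + 1) * τ)).coeff (i - (j + 1)) +
          (if 2 ≤ j then t (j + 1) else 0) * (σ ^ (j + 2)).coeff (i - (j + 1)) +
          (((j.choose 3 : ℕ) : ℚ) * 2 ^ (j - 1)) * ((((j + 3 : ℕ) : Polynomial ℚ) * σ ^ (j + 2) * τ)).coeff (i - (j + 1)) +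
          (if 3 ≤ j then s (j + 1) else 0) * (σ ^ (j + 3)).coeff (i - (j + 1)) else 0 := by
      rw [Polynomial.coeff_X_pow_mul']
      by_cases hji : j + 1 ≤ i
      · rw [if_pos hji, if_pos hji, Polynomial.coeff_add, Polynomial.coeff_add, Polynomial.coeff_add, Polynomial.coeff_add,
          Polynomial.coeff_sub, Polynomial.coeff_C_mul, Polynomial.coeff_C_mul, Polynomial.coeff_C_mul, Polynomial.coeff_C_mul,
          Polynomial.coeff_C_mul, Polynomial.coeff_C_mul]
      · rw [if_neg hji, if_neg hji]
    by_cases hji : j + 1 ≤ i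
    · have hsum : ∃ P : Polynomial ℚ, P.natDegree ≤ i ∧
          P.coeff i = ∑ n ∈ Finset.range (2 * (j + 1) + 2),
            (if n = (j + 1) + 1 then (2 : ℚ) ^ (j + 1) else 0) * (σ ^ n).coeff (i - (j + 1)) ∧
          (P * Polynomial.X).coeff i = ∑ n ∈ Finset.range (2 * (j + 1) + 2),
            ((if n = (j + 1) + 1 then (2 : ℚ) ^ (j + 1) else 0) * (((n : Polynomial ℚ) * σ ^ (n - 1) * τ)).coeff (i - (j + 1)) +
              (if n = (j + 1) + 1 then -(((j + 1 : ℕ) : ℚ) - 1) * 2 ^ (j + 1 - 1) else 0) * (σ ^ n).coeff (i - (j + 1))) ∧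
          (P * Polynomial.X ^ 2).coeff i = ∑ n ∈ Finset.range (2 * (j + 1) + 2),
            ((if n = (j + 1) + 1 then (2 : ℚ) ^ (j + 1) else 0) *
                (((n : Polynomial ℚ) * σ ^ (n - 1) * υ + ((n.choose 2 : ℕ) : Polynomial ℚ) * σ ^ (n - 2) * τ ^ 2)).coeff (i - (j + 1)) +
              (if n = (j + 1) + 1 then -(((j + 1 : ℕ) : ℚ) - 1) * 2 ^ (j + 1 - 1) else 0) *
                (((n : Polynomial ℚ) * σ ^ (n - 1) * τ)).coeff (i - (j + 1)) +
              (if n = (j + 1) + 1 then (if 3 ≤ j + 1 then (2 : ℚ) ^ (j + 1 - 3) * (((j + 1 : ℕ) : ℚ) ^ 2 - 5 * ((j + 1 : ℕ) : ℚ) + 8) else 0)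
                else if n = (j + 1) + 2 then ((((j + 1) - 1).choose 3 : ℕ) : ℚ) * 2 ^ ((j + 1) - 2) else 0) *
                (σ ^ n).coeff (i - (j + 1))) ∧
          (P * Polynomial.X ^ 3).coeff i = ∑ n ∈ Finset.range (2 * (j + 1) + 2),
            ((if n = (j + 1) + 1 then (2 : ℚ) ^ (j + 1) else 0) *
                ((n : Polynomial ℚ) * σ ^ (n - 1) * μ + 2 * ((n.choose 2 : ℕ) : Polynomial ℚ) * σ ^ (n - 2) * τ * υ +
                  ((n.choose 3 : ℕ) : Polynomial ℚ) * σ ^ (n - 3) * τ ^ 3).coeff (i - (j + 1)) +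
              (if n = (j + 1) + 1 then -(((j + 1 : ℕ) : ℚ) - 1) * 2 ^ (j + 1 - 1) else 0) *
                (((n : Polynomial ℚ) * σ ^ (n - 1) * υ + ((n.choose 2 : ℕ) : Polynomial ℚ) * σ ^ (n - 2) * τ ^ 2)).coeff (i - (j + 1)) +
              (if n = (j + 1) + 1 then (if 3 ≤ j + 1 then (2 : ℚ) ^ (j + 1 - 3) * (((j + 1 : ℕ) : ℚ) ^ 2 - 5 * ((j + 1 : ℕ) : ℚ) + 8) else 0)
                else if n = (j + 1) + 2 then ((((j + 1) - 1).choose 3 : ℕ) : ℚ) * 2 ^ ((j + 1) - 2) else 0) *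
                (((n : Polynomial ℚ) * σ ^ (n - 1) * τ)).coeff (i - (j + 1)) +
              (if n = (j + 1) + 1 then (if 3 ≤ j + 1 then t (j + 1) else 0)
                else if n = (j + 1) + 2 then (if 4 ≤ j + 1 then s (j + 1) else 0) else 0) * (σ ^ n).coeff (i - (j + 1))) ∧ ∀ d : ℕ,
          (∑ n ∈ Finset.range (2 * (j + 1) + 2),
            (costCoeffZd d (j + 1) n : ℚ) * (((CostSeries.A (costCoeffZd d) K ^ n).coeff (i - (j + 1)) : ℤ) : ℚ)) =
            P.eval (d : ℚ) := by
        refine gsc4_sum _ fun n _ => ?_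
        have h := gsc4_mul (exists_polynomial_costCoeffZd_topFour t s ht hs (Nat.succ_pos j) n)
          (symbolQuad_pow hA n (i - (j + 1)) (by omega))
        rwa [show j + 1 + (i - (j + 1)) = i by omega] at h
      obtain ⟨P, hP, hPa, hPb, hPc, hPe, h⟩ := hsum
      refine ⟨P, hP, ?_, ?_, ?_, ?_, fun d => ?_⟩
      · rw [hPa, hcoef, if_pos hji, Finset.sum_eq_single_of_mem ((j + 1) + 1)
          (Finset.mem_range.2 (by omega)) (fun n _ hn => by rw [if_neg hn, zero_mul]), if_pos rfl]
      · rw [hPb, hcoef2, if_pos hji, Finset.sum_eq_single_of_mem ((j + 1) + 1)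
          (Finset.mem_range.2 (by omega)) (fun n _ hn => by rw [if_neg hn, if_neg hn, zero_mul, zero_mul, add_zero]),
          if_pos rfl, if_pos rfl, Nat.add_sub_cancel, Nat.add_sub_cancel, show j + 1 + 1 = j + 2 from rfl]
        push_cast
        ring
      · rw [hPc, hcoef3, if_pos hji, Finset.sum_eq_add_of_mem ((j + 1) + 1) ((j + 1) + 2)
          (Finset.mem_range.2 (by omega)) (Finset.mem_range.2 (by omega)) (by omega)
          (fun n _ hn => by rw [if_neg hn.1, if_neg hn.1, if_neg hn.1, if_neg hn.2, zero_mul, zero_mul, zero_mul, add_zero, add_zero]),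
          if_pos rfl, if_pos rfl, if_pos rfl, if_neg (by omega : (j + 1) + 2 ≠ (j + 1) + 1),
          if_neg (by omega : (j + 1) + 2 ≠ (j + 1) + 1), if_neg (by omega : (j + 1) + 2 ≠ (j + 1) + 1), if_pos rfl,
          Nat.add_sub_cancel, Nat.add_sub_cancel, show j + 1 + 1 = j + 2 from rfl, show j + 1 + 2 = j + 3 from rfl,
          show j + 2 - 2 = j from rfl, show j + 1 - 3 = j - 2 by omega, show j + 1 - 2 = j - 1 by omega]
        have h3 : (if 3 ≤ j + 1 then (2 : ℚ) ^ (j - 2) * (((j + 1 : ℕ) : ℚ) ^ 2 - 5 * ((j + 1 : ℕ) : ℚ) + 8) else 0) =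
            (if 2 ≤ j then (2 : ℚ) ^ (j - 2) * ((j : ℚ) ^ 2 - 3 * j + 4) else 0) := by
          by_cases h2 : 2 ≤ j
          · rw [if_pos (by omega), if_pos h2]; push_cast; ring
          · rw [if_neg (by omega), if_neg h2]
        rw [h3]
        push_cast
        ring
      · rw [hPe, hcoef4, if_pos hji, Finset.sum_eq_add_of_mem ((j + 1) + 1) ((j + 1) + 2)
          (Finset.mem_range.2 (by omega)) (Finset.mem_range.2 (by omega)) (by omega)
          (fun n _ hn => by
            rw [if_neg hn.1, if_neg hn.1, if_neg hn.1, if_neg hn.2, if_neg hn.1, if_neg hn.2, zero_mul, zero_mul, zero_mul, zero_mul,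
              add_zero, add_zero, add_zero]),
          if_pos rfl, if_pos rfl, if_pos rfl, if_pos rfl, if_neg (by omega : (j + 1) + 2 ≠ (j + 1) + 1),
          if_neg (by omega : (j + 1) + 2 ≠ (j + 1) + 1), if_neg (by omega : (j + 1) + 2 ≠ (j + 1) + 1), if_pos rfl,
          if_neg (by omega : (j + 1) + 2 ≠ (j + 1) + 1), if_pos rfl,
          Nat.add_sub_cancel, Nat.add_sub_cancel, show j + 1 + 1 = j + 2 from rfl, show j + 1 + 2 = j + 3 from rfl,
          show j + 2 - 2 = j from rfl, show j + 2 - 3 = j - 1 by omega, show j + 3 - 2 = j + 1 from rfl, show j + 1 - 3 = j - 2 by omega,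
          show j + 1 - 2 = j - 1 by omega]
        have h3 : (if 3 ≤ j + 1 then (2 : ℚ) ^ (j - 2) * (((j + 1 : ℕ) : ℚ) ^ 2 - 5 * ((j + 1 : ℕ) : ℚ) + 8) else 0) =
            (if 2 ≤ j then (2 : ℚ) ^ (j - 2) * ((j : ℚ) ^ 2 - 3 * j + 4) else 0) := by
          by_cases h2 : 2 ≤ j
          · rw [if_pos (by omega), if_pos h2]; push_cast; ring
          · rw [if_neg (by omega), if_neg h2]
        have h4 : (if 3 ≤ j + 1 then t (j + 1) else 0) = (if 2 ≤ j then t (j + 1) else 0) := by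
          by_cases h2 : 2 ≤ j
          · rw [if_pos (by omega), if_pos h2]
          · rw [if_neg (by omega), if_neg h2]
        have h5 : (if 4 ≤ j + 1 then s (j + 1) else 0) = (if 3 ≤ j then s (j + 1) else 0) := by
          by_cases h2 : 3 ≤ j
          · rw [if_pos (by omega), if_pos h2]
          · rw [if_neg (by omega), if_neg h2]
        rw [h3, h4, h5]
        push_cast
        ring
      · rw [Polynomial.coeff_X_pow_mul', if_pos hji, ← h d, CostSeries.Pz, Polynomial.sum_comp, Polynomial.finsetSum_coeff]
        push_cast
        refine Finset.sum_congr rfl fun n _ => ?_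
        rw [Polynomial.mul_comp, Polynomial.C_comp, Polynomial.X_pow_comp, Polynomial.coeff_C_mul]
        push_cast
        rfl
    · refine ⟨0, by simp, by rw [hcoef, if_neg hji]; simp, by rw [hcoef2, if_neg hji]; simp, by rw [hcoef3, if_neg hji]; simp,
        by rw [hcoef4, if_neg hji]; simp, fun d => ?_⟩
      rw [Polynomial.coeff_X_pow_mul', if_neg hji]
      simp
  have hsum := gsc4_sum (Finset.range (K + 1)) hterm
  obtain ⟨P, hP, hPa, hPb, hPc, hPe, h⟩ := gsc4_sub ((symbolQuad_one (K + 1)) i hi) hsum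
  refine ⟨P, hP, ?_, ?_, ?_, ?_, fun d => ?_⟩
  · rw [hPa, Polynomial.coeff_sub, Polynomial.finsetSum_coeff]
  · rw [hPb, Polynomial.coeff_sub, Polynomial.finsetSum_coeff]
  · rw [hPc, Polynomial.coeff_sub, Polynomial.finsetSum_coeff]
  · rw [hPe, Polynomial.coeff_sub, Polynomial.finsetSum_coeff]
  · rw [← h d, CostSeries.A, Polynomial.coeff_sub, Polynomial.finsetSum_coeff]
    push_cast
    rfl

end Engine4


end Literature.Probability.RandomPlanarGeometry.SAW.Zd
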